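import Summits.AtomisticToContinuum.FouriersLaw.Theorems.HonestZwanzigPositiveMemoryUpperLimit
import Summits.AtomisticToContinuum.FouriersLaw.Theorems.HonestZwanzigPositiveMemoryGreenKuboFloor
import Summits.AtomisticToContinuum.FouriersLaw.Theorems.HonestZwanzigPositiveMemoryRobinReduction
import Summits.AtomisticToContinuum.FouriersLaw.Theorems.HonestZwanzigOrthogonalOhmFeshbachIdentities
import Summits.AtomisticToContinuum.FouriersLaw.Theorems.HonestZwanzigNetworkReduction

/-!
# HonestZwanzig / PositiveMemory — the NOT-INSULATING composition (line `Sketch`, v6)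

Support file for item `stmt-AtomisticToContinuum-12694` (`PositiveMemory` of route `HonestZwanzig`, sub-problem
`FouriersLaw`): the canonical composition of line `Sketch`, which needs neither the locality layer
(`stub_memoryLocality`) nor Robin coercivity (crux #4) nor the tent profile.

* `positiveMemory_of_greenKuboFloor` — `FeshbachIdentities → OrthogonalOhm → (Green–Kubo floor) → PositiveMemory`,
  where the GREEN–KUBO FLOOR is `∃ κ > 0 ∃ N₁ ∀ N ≥ N₁ (N ≥ 2), κ(N − 1) ≤ ∫₀^∞ corr_N(J,J)` (the equilibrium
  total-current autocorrelation integral of the open `N`-chain grows at least linearly). Proof: along the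
  orthogonal-dynamics DC responses `ρ_b = lim_{s↓0} schur_s(j_b, J)` of `OrthogonalOhm` (chosen once),
  `Σ_b ρ_b ≥ ∫₀^∞corr(J,J)` at every fixed `N` (`stub_upperLimit`, LANDED: time reversal on the current and
  positive definiteness of `G(s)` give `Σ_b schur_s(j_b,J) = schur_s(J,J) = lap_s(J,J) + aᵀG(s)⁻¹a ≥ lap_s(J,J)`, then
  `s ↓ 0`), hence `Σ_b ρ_b ≥ κN − κ` for large `N`; the bulk homogeneity and boundedness clauses of `OrthogonalOhm`
  force `k ≥ κ` (`ohm_floor`, LANDED), and every bulk limit is the Ohm response (uniqueness of limits in `𝓝[>] 0`),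
  hence `≥ k − κ/2 ≥ κ/2` on the bonds at distance `≥ R(κ/2)` from the ends.
* `PositiveMemory_of_notInsulating` — **`OrthogonalOhm → JunctionLocality.ConductanceLowerBound → PositiveMemory`**:
  the floor with `κ = cT²` is the landed `stub_greenKuboFloor` / `greenKuboFloor_of_conductanceLowerBound` (the
  sibling crux `ConductanceLowerBound`, item stmt-AtomisticToContinuum-11749 — `liminf_N D_N > 0`, NOT INSULATING,
  shared by routes JunctionLocality / StaticAbelianSqueeze / ContactStieltjesMeasure / ParityLiouvilleSeed and
  necessary for the conjunct — run along the canonical unique steady-state family and converted by the landed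
  Kundu–Dhar–Narayan identity `OpenChainGreenKubo`); `FeshbachIdentities` is discharged by the landed
  `HonestZwanzig.stub_feshbachIdentities`. So, GIVEN crux #2, crux #3 of route `HonestZwanzig` carries no risk
  beyond an item the summit already stakes in four other routes.
* `PositiveMemory_of_memoryConductivity` — `OrthogonalOhm → MemoryConductivity → PositiveMemory`: the floor with
  `κ = k/2` follows from the route's own conclusion node (`∫₀^∞corr(J,J)/(N−1) → k > 0`). Together with the landed
  `NetworkReduction` (`… → OrthogonalOhm → PositiveMemory → RobinCoercivity → MemoryConductivity`) this places the
  crux exactly: modulo the other items of the route, `PositiveMemory ↔ MemoryConductivity ↔ (Green–Kubo floor)`.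

* `conductanceLowerBound_of_memoryConductivity`, `conductanceLowerBound_of_cruxes` — closing the square: the conclusion
  node implies the sibling crux (KDN identity along any unique steady family), hence so do the three cruxes of the route via
  the landed `NetworkReduction` / `GeneratorSiteEnergy` / `ParityStatics` / `FeshbachIdentities`.

Every theorem is an implication between route decls; nothing is restated, no definitions, no named facts, no sorry.
-/

noncomputable section

open MeasureTheory Finset Real Set Filter Topology
open Literature.MathematicalPhysics.KineticTheory.HeatConduction
open Summit.AtomisticToContinuum.FouriersLaw.Theorems.HonestZwanzig.NetworkReduction

namespace Summit.AtomisticToContinuum.FouriersLaw.Theorems.HonestZwanzig.PositiveMemory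

/-- **Green–Kubo floor ⇒ `PositiveMemory`, given `FeshbachIdentities` and `OrthogonalOhm`.** If the equilibrium
total-current autocorrelation integral of the open chain satisfies `κ(N − 1) ≤ ∫₀^∞corr_N(J,J)` for some `κ > 0`
and all large `N`, then the orthogonal-dynamics DC responses of `OrthogonalOhm` have an `N`-uniform positive floor
`κ/2` on the bulk bonds: `Σ_b ρ_b ≥ ∫₀^∞corr(J,J)` (`stub_upperLimit`), `k ≥ κ` (`ohm_floor`), bulk limits
`≥ k − κ/2`. [cite: KunduDharNarayan2009, p. 3] -/
theorem positiveMemory_of_greenKuboFloor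
    (hFI : Summit.AtomisticToContinuum.FouriersLaw.Theses.HonestZwanzig.FeshbachIdentities)
    (hOO : Summit.AtomisticToContinuum.FouriersLaw.Theses.HonestZwanzig.OrthogonalOhm)
    (hGKF : ∀ ω₂ lam β γ : ℝ, 0 < ω₂ → 0 < lam → 0 < β → 0 < γ → ∀ T : ℝ, 0 < T →
      ∃ κ : ℝ, 0 < κ ∧ ∃ N₁ : ℕ, ∀ N : ℕ, N₁ ≤ N → 2 ≤ N →
        κ * ((N : ℝ) - 1) ≤ ∫ t in Set.Ioi (0 : ℝ),
          ((∫ z, (∑ i : Fin N, (pinnedChain ω₂ lam β γ).bondCurrent N i z) *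
              (∫ y, (∑ i : Fin N, (pinnedChain ω₂ lam β γ).bondCurrent N i y)
                ∂((pinnedChain ω₂ lam β γ).transitionKernel N T T t.toNNReal z))
              ∂((pinnedChain ω₂ lam β γ).gibbsMeasure N T)) -
            (∫ z, (∑ i : Fin N, (pinnedChain ω₂ lam β γ).bondCurrent N i z)
              ∂((pinnedChain ω₂ lam β γ).gibbsMeasure N T)) *
            (∫ z, (∑ i : Fin N, (pinnedChain ω₂ lam β γ).bondCurrent N i z)
              ∂((pinnedChain ω₂ lam β γ).gibbsMeasure N T)))) :
    Summit.AtomisticToContinuum.FouriersLaw.Theses.HonestZwanzig.PositiveMemory := by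
  intro ω₂ lam β γ hω hl hβ hγ T hT
  obtain ⟨k, C, hkC⟩ := hOO ω₂ lam β γ hω hl hβ hγ T hT
  obtain ⟨κ, hκ0, N₁, hGK⟩ := hGKF ω₂ lam β γ hω hl hβ hγ T hT
  -- the orthogonal-dynamics DC responses, chosen once (`ε = 1`)
  obtain ⟨R₁, hR₁⟩ := hkC 1 one_pos
  have hb1 := fun (N : ℕ) (hN : 2 ≤ N) => (hR₁ N hN).1
  choose ρf hρf using hb1
  have hC0 : 0 ≤ C := (abs_nonneg _).trans (hρf 2 le_rfl ⟨0, by norm_num⟩ (by norm_num)).2.1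
  set ρ : (N : ℕ) → Fin N → ℝ := fun N b => if h : 2 ≤ N ∧ b.val + 1 < N then ρf N h.1 b h.2 else 0 with hρ
  have hρt : ∀ (N : ℕ) (hN : 2 ≤ N) (b : Fin N) (hb : b.val + 1 < N), ρ N b = ρf N hN b hb := by
    intro N hN b hb
    simp only [hρ, dif_pos (And.intro hN hb)]
  have hρ0 : ∀ (N : ℕ) (b : Fin N), ¬ b.val + 1 < N → ρ N b = 0 := by
    intro N b hb
    simp only [hρ]
    rw [dif_neg]
    exact fun h => hb h.2
  -- Step A: `Σ_b ρ_b ≥ ∫₀^∞corr(J,J) ≥ κ(N − 1)` for every `N ≥ max N₁ 2`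
  have hfloor : ∀ N : ℕ, max N₁ 2 ≤ N → κ * N - κ ≤ ∑ b, ρ N b := by
    intro N hNm
    have hN : 2 ≤ N := le_of_max_le_right hNm
    have hN1 : N₁ ≤ N := le_of_max_le_left hNm
    have hup := stub_upperLimit hFI ω₂ lam β γ hω hl hβ hγ T hT N hN (ρ N)
      (fun b hb => by rw [hρt N hN b hb]; exact (hρf N hN b hb).1) (fun b hb => hρ0 N b hb)
    have hgk := hGK N hN1 hN
    dsimp only at hup hgk
    have hκN : κ * N - κ = κ * ((N : ℝ) - 1) := by ring
    rw [hκN]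
    exact hgk.trans hup
  -- Step B: the Ohm constant is at least `κ`
  have hall : ∀ N : ℕ, max N₁ 2 ≤ N → ∀ b : Fin N, |ρ N b - k| ≤ C + |k| := by
    intro N hN b
    by_cases hb : b.val + 1 < N
    · have hN2 : 2 ≤ N := le_of_max_le_right hN
      rw [hρt N hN2 b hb]
      have h := (hρf N hN2 b hb).2.1
      calc |ρf N hN2 b hb - k| ≤ |ρf N hN2 b hb| + |k| := abs_sub _ _
        _ ≤ C + |k| := by linarith
    · rw [hρ0 N b hb, zero_sub, abs_neg]
      linarith [abs_nonneg k]
  have hbulk : ∀ ε : ℝ, 0 < ε → ∃ R : ℕ, ∀ N : ℕ, max N₁ 2 ≤ N → ∀ b : Fin N,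
      R ≤ b.val → b.val + 2 + R ≤ N → |ρ N b - k| ≤ ε := by
    intro ε hε
    obtain ⟨R, hR⟩ := hkC ε hε
    refine ⟨R, fun N hN b h1 h2 => ?_⟩
    have hN2 : 2 ≤ N := le_of_max_le_right hN
    have hb : b.val + 1 < N := by omega
    obtain ⟨hbonds, -⟩ := hR N hN2
    obtain ⟨ρ', hρ', -, hρ'k⟩ := hbonds b hb
    have heq : ρf N hN2 b hb = ρ' := tendsto_nhds_unique (hρf N hN2 b hb).1 hρ'
    rw [hρt N hN2 b hb, heq]
    exact hρ'k h1 h2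
  have hk : κ ≤ k := ohm_floor (N₁ := max N₁ 2) ρ hC0 hall hbulk hfloor
  -- Step C: every bulk limit is the Ohm response, hence `≥ k − κ/2 ≥ κ/2`
  refine ⟨κ / 2, by positivity, ?_⟩
  obtain ⟨R, hR⟩ := hkC (κ / 2) (by positivity)
  refine ⟨R, fun N hN => ?_⟩
  intro P X μ corr lap e G schur J b hRb hbN ρ₀ hρ₀
  have hb : b.val + 1 < N := by omega
  obtain ⟨hbonds, -⟩ := hR N hN
  obtain ⟨ρ', hρ', -, hρ'k⟩ := hbonds b hb
  have heq : ρ₀ = ρ' := tendsto_nhds_unique hρ₀ hρ'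
  have h1 := hρ'k hRb hbN
  rw [abs_le] at h1
  rw [heq]
  linarith

/-- **`OrthogonalOhm → ConductanceLowerBound → PositiveMemory` (the NOT-INSULATING composition of line `Sketch`).**
Given crux #2 of route `HonestZwanzig`, crux #3 follows from the sibling crux `JunctionLocality.ConductanceLowerBound`
(item stmt-AtomisticToContinuum-11749, `liminf_N D_N > 0`): the Green–Kubo floor with `κ = cT²` is
`greenKuboFloor_of_conductanceLowerBound` (canonical unique steady-state family + the Kundu–Dhar–Narayan identity
`OpenChainGreenKubo`, all landed), and `FeshbachIdentities` is the landed `HonestZwanzig.stub_feshbachIdentities`.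
[cite: KunduDharNarayan2009, p. 3] -/
theorem PositiveMemory_of_notInsulating :
    Summit.AtomisticToContinuum.FouriersLaw.Theses.HonestZwanzig.OrthogonalOhm →
    Summit.AtomisticToContinuum.FouriersLaw.Theses.JunctionLocality.ConductanceLowerBound →
    Summit.AtomisticToContinuum.FouriersLaw.Theses.HonestZwanzig.PositiveMemory := by
  intro hOO hCLB
  refine positiveMemory_of_greenKuboFloor
    Summit.AtomisticToContinuum.FouriersLaw.Theorems.HonestZwanzig.stub_feshbachIdentities hOO ?_
  intro ω₂ lam β γ hω hl hβ hγ T hT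
  obtain ⟨c, hc, N₁, h⟩ := greenKuboFloor_of_conductanceLowerBound hCLB hω hl hβ hγ hT
  refine ⟨c * T ^ 2, by positivity, N₁, fun N hN1 hN2 => ?_⟩
  have key := h N hN1 hN2
  calc c * T ^ 2 * ((N : ℝ) - 1) = c * (((N : ℝ) - 1) * T ^ 2) := by ring
    _ ≤ _ := key

/-- **`OrthogonalOhm → MemoryConductivity → PositiveMemory`.** The route's own conclusion node
(`∫₀^∞corr_N(J,J)/(N − 1) → k > 0`) supplies the Green–Kubo floor with `κ = k/2`; with the landed
`NetworkReduction` (`… → PositiveMemory → RobinCoercivity → MemoryConductivity`) this shows that, modulo the other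
items of route `HonestZwanzig`, crux #3 is EQUIVALENT to the conclusion node and to the Green–Kubo floor.
[cite: KunduDharNarayan2009, p. 3] -/
theorem PositiveMemory_of_memoryConductivity
    (hOO : Summit.AtomisticToContinuum.FouriersLaw.Theses.HonestZwanzig.OrthogonalOhm)
    (hMC : Summit.AtomisticToContinuum.FouriersLaw.Theses.HonestZwanzig.MemoryConductivity) :
    Summit.AtomisticToContinuum.FouriersLaw.Theses.HonestZwanzig.PositiveMemory := by
  refine positiveMemory_of_greenKuboFloor
    Summit.AtomisticToContinuum.FouriersLaw.Theorems.HonestZwanzig.stub_feshbachIdentities hOO ?_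
  intro ω₂ lam β γ hω hl hβ hγ T hT
  obtain ⟨k, hk, hlim⟩ := hMC ω₂ lam β γ hω hl hβ hγ T hT
  have hev := (tendsto_order.1 hlim).1 (k / 2) (by linarith)
  rw [Filter.eventually_atTop] at hev
  obtain ⟨N₁, hN₁⟩ := hev
  refine ⟨k / 2, by positivity, N₁, fun N hN1 hN2 => ?_⟩
  have h := hN₁ N hN1
  dsimp only at h
  have hpos : (0 : ℝ) < (N : ℝ) - 1 := by
    have : (2 : ℝ) ≤ N := by exact_mod_cast hN2
    linarith
  rw [lt_div_iff₀ hpos] at h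
  exact h.le

/-- **`MemoryConductivity → ConductanceLowerBound` (closing the loop).** The conclusion node of route
`HonestZwanzig` implies the sibling crux NOT-INSULATING: along any unique steady-state family with response
coefficients `D_N`, the landed Kundu–Dhar–Narayan identity `OpenChainGreenKubo` gives
`D_N = ∫₀^∞corr_N(J,J)/((N−1)T²)` for `N ≥ 2`, and `∫₀^∞corr_N(J,J)/(N−1) → k > 0` makes `D_N ≥ k/(2T²)`
eventually. With `PositiveMemory_of_notInsulating` and the landed `NetworkReduction`: modulo the other items of
the route, `PositiveMemory ↔ ConductanceLowerBound ↔ MemoryConductivity`. [cite: KunduDharNarayan2009, p. 3] -/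
theorem conductanceLowerBound_of_memoryConductivity
    (hMC : Summit.AtomisticToContinuum.FouriersLaw.Theses.HonestZwanzig.MemoryConductivity) :
    Summit.AtomisticToContinuum.FouriersLaw.Theses.JunctionLocality.ConductanceLowerBound := by
  intro ω₂ lam β γ hω hl hβ hγ hU μ hμ T hT D hD
  obtain ⟨k, hk, hlim⟩ := hMC ω₂ lam β γ hω hl hβ hγ T hT
  have hev := (tendsto_order.1 hlim).1 (k / 2) (by linarith)
  rw [Filter.eventually_atTop] at hev
  obtain ⟨N₁, hN₁⟩ := hev
  refine ⟨k / 2 / T ^ 2, by positivity, max N₁ 2, fun N hN => ?_⟩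
  have hN2 : 2 ≤ N := le_of_max_le_right hN
  have hN1 : N₁ ≤ N := le_of_max_le_left hN
  obtain ⟨-, hGK⟩ :=
    Summit.AtomisticToContinuum.FouriersLaw.Theorems.OddSectorIrreversibility.Corrector.openChainGreenKubo_holds
      ω₂ lam β γ hω hl hβ hγ hU μ hμ T hT N hN2
  have hDN := tendsto_nhds_unique (hD N) hGK
  have h := hN₁ N hN1
  dsimp only at h hDN
  have hpos : (0 : ℝ) < (N : ℝ) - 1 := by
    have : (2 : ℝ) ≤ N := by exact_mod_cast hN2
    linarith
  rw [hDN, ← div_div]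
  gcongr

/-- **`OrthogonalOhm → PositiveMemory → RobinCoercivity → ConductanceLowerBound` (the square closes).** The three
cruxes of route `HonestZwanzig` give `MemoryConductivity` by the landed `NetworkReduction` (fed the landed
`GeneratorSiteEnergy`, `ParityStatics`, `FeshbachIdentities`), hence the sibling crux NOT-INSULATING by
`conductanceLowerBound_of_memoryConductivity`. Together with `PositiveMemory_of_notInsulating`:
given cruxes #2 and #4, `PositiveMemory ↔ JunctionLocality.ConductanceLowerBound`. [cite: KunduDharNarayan2009, p. 3] -/
theorem conductanceLowerBound_of_cruxes
    (hOO : Summit.AtomisticToContinuum.FouriersLaw.Theses.HonestZwanzig.OrthogonalOhm)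
    (hPM : Summit.AtomisticToContinuum.FouriersLaw.Theses.HonestZwanzig.PositiveMemory)
    (hRC : Summit.AtomisticToContinuum.FouriersLaw.Theses.HonestZwanzig.RobinCoercivity) :
    Summit.AtomisticToContinuum.FouriersLaw.Theses.JunctionLocality.ConductanceLowerBound :=
  conductanceLowerBound_of_memoryConductivity
    (networkReduction_proof Summit.AtomisticToContinuum.FouriersLaw.Theorems.HonestZwanzig.generatorSiteEnergy_proof
      Summit.AtomisticToContinuum.FouriersLaw.Theorems.HonestZwanzig.parityStatics_proof
      Summit.AtomisticToContinuum.FouriersLaw.Theorems.HonestZwanzig.stub_feshbachIdentities hOO hPM hRC)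

/-- **The normal form of crux #3, given cruxes #2 and #4**: `PositiveMemory ↔ ConductanceLowerBound`.
[cite: KunduDharNarayan2009, p. 3] -/
theorem positiveMemory_iff_conductanceLowerBound
    (hOO : Summit.AtomisticToContinuum.FouriersLaw.Theses.HonestZwanzig.OrthogonalOhm)
    (hRC : Summit.AtomisticToContinuum.FouriersLaw.Theses.HonestZwanzig.RobinCoercivity) :
    Summit.AtomisticToContinuum.FouriersLaw.Theses.HonestZwanzig.PositiveMemory ↔
      Summit.AtomisticToContinuum.FouriersLaw.Theses.JunctionLocality.ConductanceLowerBound :=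
  ⟨fun hPM => conductanceLowerBound_of_cruxes hOO hPM hRC, fun hCLB => PositiveMemory_of_notInsulating hOO hCLB⟩

end Summit.AtomisticToContinuum.FouriersLaw.Theorems.HonestZwanzig.PositiveMemory

end
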